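import Summits.FinalStateConjecture.FinalStateConjecture.Theorems.PhaseMixingCaptureBulkKerrCaptureC2ReflectionSobolev
import Summits.FinalStateConjecture.FinalStateConjecture.Theorems.PhaseMixingCaptureBulkKerrCaptureC2MassNormalisation
import Summits.FinalStateConjecture.FinalStateConjecture.Theorems.PhaseMixingCaptureBulkKerrCaptureC2SubextremalLimit
import HarnessLib

/-!
# Crux `PhaseMixingCapture.BulkKerrCaptureC2` (stmt-FinalStateConjecture-14985): SPIN REVERSAL — the block
# `CaptureC2At` is even in the spin; the crux is equivalent to its restriction to spins `0 ≤ a ≤ a₁ M`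

Support file for the crux `BulkKerrCaptureC2` (sub-extremal Kerr capture in the bulk, import grade, `C²` handed
over), assembling the Reflection package (`…ReflectionKerrSchild`, `…ReflectionConvergence`, `…ReflectionData`,
`…ReflectionSobolev`).  Reversing the sense of rotation, `a ↦ −a`, is realised on the Kerr–Schild slice by the
Euclidean reflection `L₃ : y₁ ↦ −y₁`, which maps `Kerr.slice (−a) M` onto `Kerr.slice a M`, pulls `Kerr.data M a M` back
to `Kerr.data M (−a) M` (`comap_sliceReflect_kerrData`), preserves the vacuum constraints, the weighted Sobolev
distances (`dataWeightedSobolevEDist_comap_sliceReflect`) and — re-basing a maximal development along it — maximality,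
far-completeness of `𝓘⁺` (the reflection is exactly far-compatible: `‖L₃ y‖ = ‖y‖`, `afRadius (−a) M = afRadius a M`)
and `C²`-convergence to Kerr up to the sign of the final spin (`convergesToKerr_neg`).  Hence:

* `conclusion_reflect` — the conclusion of the crux for the maximal developments of a datum `D'` on `Kerr.slice b M`,
  `b = −a`, with tolerance `η` about `(M, b)`, follows from the conclusion for the maximal developments of its
  reflection `G^* D'` on `Kerr.slice a M` with tolerance `η` about `(M, a)` (witness `(M', −a')`);
* `captureC2At_reflect`, **`captureC2At_neg_iff`** — `CaptureC2At s δ M _ ε η (−a) ↔ CaptureC2At s δ M _ ε η a`, with the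
  SAME `(s, δ, ε, η)`;
* **`bulkKerrCaptureC2_iff_nonnegSpin`** — the crux is equivalent to its restriction to spins `0 ≤ a ≤ a₁ M`;
* **`bulkKerrCaptureC2_iff_unitMass_nonnegSpin`** — … and, with the mass normalisation
  (`Scaling.bulkKerrCaptureC2_iff_unitMass`), to capture at unit mass for spins `0 ≤ a ≤ a₁`: the parameter space
  `{(M, a) : M > 0, |a| ≤ a₁ M}` of the crux collapses to the segment `{1} × [0, a₁]` (registered sub-goal
  `stub_bulkKerrCaptureC2_iff_unitMass_nonnegSpin`);
* **`bulkKerrCaptureC2_iff_reducedForm`** — THE REDUCED FORM OF THE CRUX: unit mass, spins `0 ≤ a ≤ a₁`, and the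
  conclusion WITHOUT the (redundant, `Prefix.bulkKerrCaptureC2_iff_dropSubextremal`) sub-extremality conjunct —
  `∀ a₁ < 1, ∃ (s, δ), ∀ η > 0, ∃ ε > 0, ∀ a ∈ [0, a₁]`, every b-conormal vacuum datum on `Kerr.slice a 1` within `ε` of
  `Kerr.data 1 a 1` has all its maximal vacuum Cauchy developments far-complete with a region converging in `C²` to
  SOME `g_{M',a'}`, `|M' − 1| + |a' − a| ≤ η`.

Prior tree result: the orientation blindness of `ConvergesToKerr` was first recorded as
`StubSpinReflection.convergesToKerr_neg` (`…/Theorems/PhaseMixingCaptureBulkKerrCaptureStubSpinReflection.lean`, stub of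
the line `frozen-charge-flat-modulus` of the PREDECESSOR crux `BulkKerrCapture`, 2026-08-16, via the concrete reflection
`reflY`); `Reflection.convergesToKerr_neg` of `…ReflectionConvergence` re-derives it for arbitrary isometric reference
backgrounds.  The data side (`comap_sliceReflect_kerrData`, `dataWeightedSobolevEDist_comap_sliceReflect`) and the block
consequences below are new.

Nothing here closes the crux.  Everything is proved; no definitions, no named facts.  References: B. O'Neill, *The
geometry of Kerr black holes* (1995), Ch. 2, §2.1–2.2 (`a ↦ −a` reverses the sense of rotation); R. P. Kerr,
A. Schild (1965), §2; R. Bartnik, J. Isenberg (2004), §2; H. Ringström (2009), Def. 16.5; D. Christodoulou, CQG 16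
(1999), pp. A26–A27; M. Dafermos, G. Holzegel, I. Rodnianski, M. Taylor, arXiv:2104.08222, §1.
-/

-- the doubled `FinalStateConjecture.FinalStateConjecture` path component trips dupNamespace
set_option linter.dupNamespace false

noncomputable section

open Set Function Topology
open scoped Manifold ContDiff Topology
open Literature.Geometry.Lorentzian
open Summit.FinalStateConjecture.FinalStateConjecture.Theses.PhaseMixingCapture (BulkKerrCaptureC2)
open Summit.FinalStateConjecture.FinalStateConjecture.Theorems.BulkKerrCaptureC2.Negative
  (CaptureC2At bulkKerrCaptureC2_iff_captureC2At)
open Summit.FinalStateConjecture.FinalStateConjecture.Theorems.BulkKerrCapture.Negative (range_farSliceIncl)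
open Summit.FinalStateConjecture.FinalStateConjecture.Theorems.BulkKerrCaptureC2.Scaling
  (embedsInto_comapAlong_of_isMaximal hasCompleteFutureNullInfinityFrom_of_comapAlong bulkKerrCaptureC2_iff_unitMass)
open Summit.FinalStateConjecture.FinalStateConjecture.Theorems.ZeroEnergyRigidity.Negative (isSubextremal_neg_iff)

namespace Summit.FinalStateConjecture.FinalStateConjecture.Theorems.BulkKerrCaptureC2.Reflection

/-! ## §1 The conclusion of the crux descends along the reflection of the slice -/

section Conclusion

variable [Kerr.Facts] [Kerr.SliceFacts]
  {L : E4 ≃ₗᵢ[ℝ] E4} (hL : ∀ (x : E4) (i : Fin 4), L x i = if i = 2 then -x i else x i)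
  {L₃ : E3 ≃ₗᵢ[ℝ] E3} (hL₃ : ∀ (y : E3) (i : Fin 3), L₃ y i = if i = 1 then -y i else y i)
  {M a b : ℝ}
include hL hL₃

omit [Kerr.Facts] hL in
/-- **The conclusion of the crux descends along the reflection of the slice.**  Let `b = −a`, let `D'` be a datum on
`Kerr.slice b M` and `G : Kerr.slice a M ≃ₜ Kerr.slice b M` the reflection (`G = L₃` in coordinates).  If every maximal
vacuum Cauchy development of the reflected datum `G^* D'` is far-complete with a region converging in `C²` to a
sub-extremal `g_{M',a'}`, `|M' − M| + |a' − a| ≤ η`, then every maximal vacuum Cauchy development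
`𝒟' = (𝓜, g, τ, ι, ν)` of `D'` is far-complete with a region converging in `C²` to the sub-extremal `g_{M',−a'}`,
`|M' − M| + |−a' − b| ≤ η`: the re-based development `(𝓜, g, τ, ι ∘ G, ν ∘ G)` of `G^* D'` is maximal
(`embedsInto_comapAlong_of_isMaximal`), far-completeness descends along the exactly far-compatible `G⁻¹`
(`hasCompleteFutureNullInfinityFrom_of_comapAlong`; `‖G⁻¹ p‖ = ‖p‖`, `afRadius (−a) M = afRadius a M`), and
`C²`-convergence to `g_{M',a'}` is `C²`-convergence to `g_{M',−a'}` (`convergesToKerr_neg`).  Ringström 2009, Def. 16.5;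
Christodoulou 1999, pp. A26–A27; Kerr–Schild 1965, §2. [cite: Ringstrom2009, Def. 16.5] -/
theorem conclusion_reflect (hba : b = -a) {η : ℝ} {D' : InitialDataSet 𝓘(ℝ, E3) (Kerr.slice b M)}
    {G : Kerr.slice a M ≃ₜ Kerr.slice b M} (hG : ∀ z, ((G z : Kerr.slice b M) : E3) = L₃ z)
    (hGc : ContMDiff (𝓡 3) (𝓡 3) (∞ + 1) G) (hGi : ∀ u, Injective (mfderiv (𝓡 3) (𝓡 3) G u))
    (h : ∀ 𝒟 : VacuumCauchyDevelopment (D'.comap G hGc hGi), 𝒟.IsMaximal →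
      ∃ (M' a' : ℝ) (𝒟oc : Set 𝒟.carrier), Kerr.IsSubextremal M' a' ∧ 𝒟.HasCompleteFutureNullInfinityFar ∧
        𝒟.toSpacetime.ConvergesToKerr 𝒟oc M' a' 2 ∧ |M' - M| + |a' - a| ≤ η)
    (𝒟' : VacuumCauchyDevelopment D') (hmax' : 𝒟'.IsMaximal) :
    ∃ (M' a' : ℝ) (𝒟oc : Set 𝒟'.carrier), Kerr.IsSubextremal M' a' ∧ 𝒟'.HasCompleteFutureNullInfinityFar ∧
      𝒟'.toSpacetime.ConvergesToKerr 𝒟oc M' a' 2 ∧ |M' - M| + |a' - b| ≤ η := by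
  -- the inverse reflection is the same map in coordinates, hence smooth with injective differentials
  have hGs_coe : ∀ y, ((G.symm y : Kerr.slice a M) : E3) = L₃ y := coe_sliceReflect_symm hL₃ hG
  have hGs : ContMDiff (𝓡 3) (𝓡 3) (∞ + 1) G.symm := contMDiff_isom hGs_coe
  have hGs' : ∀ u, Injective (mfderiv (𝓡 3) (𝓡 3) G.symm u) := injective_mfderiv_isom hGs_coe
  -- `𝒟'` re-based along `G`: a maximal development of `G^* D'`
  let 𝒟₁ : VacuumCauchyDevelopment (D'.comap G hGc hGi) :=
    { toDataEmbedding := 𝒟'.toDataEmbedding.comapAlong G hGc hGi G.isOpenEmbedding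
        fun u ↦ 𝒟'.toDataEmbedding.mdifferentiableAt_embed_normal (G u)
      isCauchyHypersurface := by
        show 𝒟'.metric.IsCauchyHypersurface 𝒟'.timeOrientation (range (𝒟'.embed ∘ G))
        rw [G.surjective.range_comp]
        exact 𝒟'.isCauchyHypersurface
      isRicciFlat := by
        intro inst
        haveI : 𝒟'.metric.toPseudoRiemannianMetric.HasLeviCivita := inst
        exact 𝒟'.isRicciFlat }
  have hmax₁ : 𝒟₁.IsMaximal := fun 𝒟'' ↦ embedsInto_comapAlong_of_isMaximal 𝒟' hmax' G hGc hGi hGs hGs' 𝒟''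
  obtain ⟨M', a', 𝒟oc, hsub, hfar₁, hconv₁, hpar⟩ := h 𝒟₁ hmax₁
  refine ⟨M', -a', 𝒟oc, (isSubextremal_neg_iff M' a').2 hsub, ?_, ?_, ?_⟩
  · -- far-completeness descends along the re-basing; `G⁻¹` is exactly far-compatible
    rw [DataEmbedding.hasCompleteFutureNullInfinityFar_iff, range_farSliceIncl] at hfar₁ ⊢
    refine hasCompleteFutureNullInfinityFrom_of_comapAlong 𝒟'.toDataEmbedding G hGc hGi
      (fun u ↦ 𝒟'.toDataEmbedding.mdifferentiableAt_embed_normal (G u)) isCompact_empty (fun p hp _ ↦ ?_) hfar₁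
    change Kerr.afRadius a M + 1 ≤ ‖((G.symm p : Kerr.slice a M) : E3)‖
    have hp' : Kerr.afRadius b M + 1 ≤ ‖(p : E3)‖ := hp
    rw [hGs_coe, L₃.norm_map]
    subst hba
    rwa [afRadius_neg] at hp'
  · -- convergence: the same region converges to `g_{M',−a'}`
    exact convergesToKerr_neg 𝒟'.toSpacetime hconv₁
  · -- the parameters
    subst hba
    have e : -a' - -a = -(a' - a) := by ring
    rw [e, abs_neg]
    exact hpar

end Conclusion

/-! ## §2 The block is even in the spin -/

section Block

variable [Kerr.Facts] [Kerr.SliceFacts]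
  {L : E4 ≃ₗᵢ[ℝ] E4} (hL : ∀ (x : E4) (i : Fin 4), L x i = if i = 2 then -x i else x i)
  {L₃ : E3 ≃ₗᵢ[ℝ] E3} (hL₃ : ∀ (y : E3) (i : Fin 3), L₃ y i = if i = 1 then -y i else y i)
include hL hL₃

/-- **Spin reversal of the block.**  `CaptureC2At s δ M _ ε η a → CaptureC2At s δ M _ ε η b` for `b = −a`, with the same
`(s, δ, ε, η)`: given an admissible datum `D'` on `Kerr.slice b M`, its reflection `D = G^* D'` on `Kerr.slice a M`
(`G : Kerr.slice a M ≃ₜ Kerr.slice b M` the slice reflection) is vacuum (`isVacuumConstraintSolution_comap'`), and since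
`Kerr.data M a M = G^* Kerr.data M b M` (`comap_sliceReflect_kerrData`) its distances to the centre are those of `D'`
(`dataWeightedSobolevEDist_comap_sliceReflect`); the block at spin `a` gives the conclusion for the maximal developments
of `D`, which descends to those of `D'` (`conclusion_reflect`).  O'Neill 1995, Ch. 2, §2.1; Bartnik–Isenberg 2004, §2.
[cite: ONeill1995, Ch. 2 §2.1] -/
theorem captureC2At_reflect {M a b : ℝ} (hba : b = -a) {s : ℕ} {δ : ℝ} {hM : 0 ≤ M} {ε η : ℝ}
    (h : CaptureC2At s δ M hM ε η a) : CaptureC2At s δ M hM ε η b := by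
  have hab : a = -b := by rw [hba, neg_neg]
  obtain ⟨G, hG⟩ := exists_sliceReflect hL hL₃ (a := b) (b := a) hab M
  have hGc : ContMDiff (𝓡 3) (𝓡 3) (∞ + 1) G := contMDiff_isom hG
  have hGi : ∀ u, Injective (mfderiv (𝓡 3) (𝓡 3) G u) := injective_mfderiv_isom hG
  intro D' _ hvac hcon hdist 𝒟' hmax'
  -- the reflected datum on `Kerr.slice a M`
  haveI : (D'.comap G hGc hGi).metric.HasLeviCivita := (D'.comap G hGc hGi).metric.hasLeviCivita
  have hvacD : (D'.comap G hGc hGi).IsVacuumConstraintSolution := D'.isVacuumConstraintSolution_comap' hGc hGi hvac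
  have hK : Kerr.data M a M hM = (Kerr.data M b M hM).comap G hGc hGi :=
    (comap_sliceReflect_kerrData hL hL₃ hG hab hM hGc hGi).symm
  have hdistD : ∀ s' : ℕ, InitialDataSet.dataWeightedSobolevEDist s' δ (D'.comap G hGc hGi) (Kerr.data M a M hM) =
      InitialDataSet.dataWeightedSobolevEDist s' δ D' (Kerr.data M b M hM) := fun s' ↦ by
    rw [hK]
    exact dataWeightedSobolevEDist_comap_sliceReflect hL hL₃ hG hab hGc hGi s' δ D' _
  have hconD : ∀ s' : ℕ,
      InitialDataSet.dataWeightedSobolevEDist s' δ (D'.comap G hGc hGi) (Kerr.data M a M hM) < ⊤ := fun s' ↦ by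
    rw [hdistD]; exact hcon s'
  have hdD : InitialDataSet.dataWeightedSobolevEDist s δ (D'.comap G hGc hGi) (Kerr.data M a M hM) <
      ENNReal.ofReal ε := by
    rw [hdistD]; exact hdist
  exact conclusion_reflect hL₃ hba hG hGc hGi (h _ hvacD hconD hdD) 𝒟' hmax'

end Block

/-! ## §3 The crux on the nonnegative spins -/

/-- **`CaptureC2At s δ M _ ε η (−a) ↔ CaptureC2At s δ M _ ε η a`**: the block of the crux is even in the spin, with the
same regularity, weight, basin and tolerance (`captureC2At_reflect` both ways, the reflections supplied by
`exists_reflections`).  O'Neill 1995, Ch. 2, §2.1. [cite: ONeill1995, Ch. 2 §2.1] -/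
theorem captureC2At_neg_iff [Kerr.Facts] [Kerr.SliceFacts] {s : ℕ} {δ M : ℝ} {hM : 0 ≤ M} {ε η a : ℝ} :
    CaptureC2At s δ M hM ε η (-a) ↔ CaptureC2At s δ M hM ε η a := by
  obtain ⟨L, L₃, hL, hL₃⟩ := exists_reflections
  exact ⟨fun h ↦ captureC2At_reflect hL hL₃ (neg_neg a).symm h, fun h ↦ captureC2At_reflect hL hL₃ rfl h⟩

/-- **The crux is equivalent to its restriction to nonnegative spins**: `BulkKerrCaptureC2` iff for every `a₁ < 1`
there are `(s, δ)` such that for every `M > 0`, `η > 0` one basin `ε > 0` serves every spin `0 ≤ a ≤ a₁ M`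
(for `−a₁ M ≤ a < 0` use the block at `−a`, `captureC2At_neg_iff`).  O'Neill 1995, Ch. 2, §2.1.
[cite: ONeill1995, Ch. 2 §2.1] -/
theorem bulkKerrCaptureC2_iff_nonnegSpin :
    BulkKerrCaptureC2 ↔
      ∀ [Kerr.Facts] [Kerr.SliceFacts], ∀ a₁ : ℝ, a₁ < 1 → ∃ (s : ℕ) (δ : ℝ),
        ∀ (M : ℝ) (hM : 0 < M), ∀ η > (0 : ℝ), ∃ ε > (0 : ℝ), ∀ a : ℝ, 0 ≤ a → a ≤ a₁ * M →
          CaptureC2At s δ M hM.le ε η a := by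
  rw [bulkKerrCaptureC2_iff_captureC2At]
  constructor
  · intro h _ _ a₁ ha₁
    obtain ⟨s, δ, H⟩ := h a₁ ha₁
    refine ⟨s, δ, fun M hM η hη ↦ ?_⟩
    obtain ⟨ε, hε, Hε⟩ := H M hM η hη
    exact ⟨ε, hε, fun a h0 ha ↦ Hε a (by rwa [abs_of_nonneg h0])⟩
  · intro h _ _ a₁ ha₁
    obtain ⟨s, δ, H⟩ := h a₁ ha₁
    refine ⟨s, δ, fun M hM η hη ↦ ?_⟩
    obtain ⟨ε, hε, Hε⟩ := H M hM η hη
    refine ⟨ε, hε, fun a ha ↦ ?_⟩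
    rcases le_or_gt 0 a with h0 | h0
    · exact Hε a h0 ((le_abs_self a).trans ha)
    · exact captureC2At_neg_iff.1 (Hε (-a) (by linarith) ((neg_le_abs a).trans ha))

/-- **The crux is equivalent to unit-mass capture on the nonnegative spins**: `BulkKerrCaptureC2` iff for every
`a₁ < 1` there are `(s, δ)` such that for every `η > 0` one basin `ε > 0` gives `CaptureC2At s δ 1 _ ε η a` for every
`0 ≤ a ≤ a₁` — the mass normalisation `Scaling.bulkKerrCaptureC2_iff_unitMass` followed by spin reversal
(`captureC2At_neg_iff`): the parameter space `{(M, a) : M > 0, |a| ≤ a₁ M}` of the crux collapses to the segment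
`{1} × [0, a₁]`.  Kerr–Schild 1965, §2 (homogeneity); O'Neill 1995, Ch. 2, §2.1 (spin reversal).
[cite: ONeill1995, Ch. 2 §2.1] -/
theorem bulkKerrCaptureC2_iff_unitMass_nonnegSpin :
    BulkKerrCaptureC2 ↔
      ∀ [Kerr.Facts] [Kerr.SliceFacts], ∀ a₁ : ℝ, a₁ < 1 → ∃ (s : ℕ) (δ : ℝ),
        ∀ η > (0 : ℝ), ∃ ε > (0 : ℝ), ∀ a : ℝ, 0 ≤ a → a ≤ a₁ → CaptureC2At s δ 1 zero_le_one ε η a := by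
  rw [bulkKerrCaptureC2_iff_unitMass]
  constructor
  · intro h _ _ a₁ ha₁
    obtain ⟨s, δ, H⟩ := h a₁ ha₁
    refine ⟨s, δ, fun η hη ↦ ?_⟩
    obtain ⟨ε, hε, Hε⟩ := H η hη
    exact ⟨ε, hε, fun a h0 ha ↦ Hε a (by rwa [abs_of_nonneg h0])⟩
  · intro h _ _ a₁ ha₁
    obtain ⟨s, δ, H⟩ := h a₁ ha₁
    refine ⟨s, δ, fun η hη ↦ ?_⟩
    obtain ⟨ε, hε, Hε⟩ := H η hη
    refine ⟨ε, hε, fun a ha ↦ ?_⟩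
    rcases le_or_gt 0 a with h0 | h0
    · exact Hε a h0 ((le_abs_self a).trans ha)
    · exact captureC2At_neg_iff.1 (Hε (-a) (by linarith) ((neg_le_abs a).trans ha))

/-! ## §4 The reduced form of the crux -/

/-- **The reduced form of `BulkKerrCaptureC2`.**  The crux is equivalent to: for every `a₁ < 1` there are `(s, δ)` such
that for every `η > 0` one basin `ε > 0` serves every spin `0 ≤ a ≤ a₁` AT UNIT MASS, in the sense that every vacuum
datum `D` on `Kerr.slice a 1`, b-conormal relative to `Kerr.data 1 a 1` and within `H^s_δ`-distance `ε` of it, has all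
its maximal vacuum Cauchy developments far-complete with a region converging in `C²` to SOME Kerr metric `g_{M',a'}`
with `|M' − 1| + |a' − a| ≤ η` — no sub-extremality conjunct (it is forced, `Prefix.captureC2At_of_weak`), no negative
spins (`captureC2At_neg_iff`), no other masses (`Scaling.bulkKerrCaptureC2_iff_unitMass`).  This is the statement a
direct proof or a discharge of the imported claim has to establish, and nothing less.  Kerr–Schild 1965, §2; O'Neill
1995, Ch. 2, §2.1; DHRT arXiv:2104.08222, §1. [cite: ONeill1995, Ch. 2 §2.1] -/
theorem bulkKerrCaptureC2_iff_reducedForm :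
    BulkKerrCaptureC2 ↔
      ∀ [Kerr.Facts] [Kerr.SliceFacts], ∀ a₁ : ℝ, a₁ < 1 → ∃ (s : ℕ) (δ : ℝ),
        ∀ η > (0 : ℝ), ∃ ε > (0 : ℝ), ∀ a : ℝ, 0 ≤ a → a ≤ a₁ →
          ∀ (D : InitialDataSet 𝓘(ℝ, E3) (Kerr.slice a 1)) [D.metric.HasLeviCivita],
            D.IsVacuumConstraintSolution →
            (∀ s' : ℕ,
              InitialDataSet.dataWeightedSobolevEDist s' δ D (Kerr.data 1 a 1 zero_le_one) < ⊤) →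
            InitialDataSet.dataWeightedSobolevEDist s δ D (Kerr.data 1 a 1 zero_le_one) < ENNReal.ofReal ε →
            ∀ 𝒟 : VacuumCauchyDevelopment D, 𝒟.IsMaximal →
              ∃ (M' a' : ℝ) (𝒟oc : Set 𝒟.carrier),
                𝒟.HasCompleteFutureNullInfinityFar ∧
                𝒟.toSpacetime.ConvergesToKerr 𝒟oc M' a' 2 ∧ |M' - 1| + |a' - a| ≤ η := by
  rw [bulkKerrCaptureC2_iff_unitMass_nonnegSpin]
  constructor
  · intro h _ _ a₁ ha₁
    obtain ⟨s, δ, H⟩ := h a₁ ha₁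
    refine ⟨s, δ, fun η hη ↦ ?_⟩
    obtain ⟨ε, hε, Hε⟩ := H η hη
    exact ⟨ε, hε, fun a h0 ha ↦ Prefix.weak_of_captureC2At (Hε a h0 ha)⟩
  · intro h _ _ a₁ ha₁
    obtain ⟨s, δ, H⟩ := h a₁ ha₁
    refine ⟨s, δ, fun η hη ↦ ?_⟩
    obtain ⟨ε, hε, Hε⟩ := H (min η ((1 - a₁) * 1 / 4)) (Prefix.tolerance_pos one_pos ha₁ hη)
    refine ⟨ε, hε, fun a h0 ha ↦ ?_⟩
    have ha' : |a| ≤ a₁ * 1 := by rwa [abs_of_nonneg h0, mul_one]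
    exact Prefix.captureC2At_of_weak one_pos ha₁ ha' (min_le_left _ _) (min_le_right _ _) (Hε a h0 ha)

/-- **Registered sub-goal `stub_bulkKerrCaptureC2_iff_unitMass_nonnegSpin`** (crux item stmt-FinalStateConjecture-14985):
the crux is equivalent to unit-mass `C²` capture on the nonnegative spins `0 ≤ a ≤ a₁` (closed form of
`bulkKerrCaptureC2_iff_unitMass_nonnegSpin`). [cite: ONeill1995, Ch. 2 §2.1] -/
theorem stub_bulkKerrCaptureC2_iff_unitMass_nonnegSpin : BulkKerrCaptureC2 ↔ ∀ [Kerr.Facts] [Kerr.SliceFacts], ∀ a₁ : ℝ, a₁ < 1 → ∃ (s : ℕ) (δ : ℝ), ∀ η > (0 : ℝ), ∃ ε > (0 : ℝ), ∀ a : ℝ, 0 ≤ a → a ≤ a₁ → CaptureC2At s δ 1 zero_le_one ε η a :=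
  bulkKerrCaptureC2_iff_unitMass_nonnegSpin

/-! ## §5 Locally uniform capture around the nonnegative unit-mass centres -/

/-- **The crux is locally uniform `C²` capture around each unit-mass Kerr `g_{1,χ}` with `0 ≤ χ < 1`.**
`BulkKerrCaptureC2` holds iff around every normalised centre `χ ∈ [0, 1)` there are exponents `(s, δ)`, a spin radius
`ς > 0` and, per tolerance `η > 0`, one basin `ε > 0` such that `CaptureC2At s δ 1 _ ε η a` holds for every
sub-extremal spin `a` with `|a − χ| < ς` — the two-sided normal form `Scaling.bulkKerrCaptureC2_iff_unitMass_locallyUniform`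
halved by the evenness of the block (`captureC2At_neg_iff`: a centre `χ < 0` is served by the data of the centre `−χ`,
since `|−a − (−χ)| = |a − χ|` and `|−a| < 1 ↔ |a| < 1`).  This is exactly what a nonlinear stability theorem of ONE
Kerr black hole `g_{1,χ}`, `0 ≤ χ < 1`, with constants locally uniform in the spin (Hintz 2026, Thm. 13.1 with
Rem. 13.2, read at `M = 1`, `χ₀ ≥ 0`) provides, and nothing less is needed.  O'Neill 1995, Ch. 2, §2.1.
[cite: ONeill1995, Ch. 2 §2.1] -/
theorem bulkKerrCaptureC2_iff_unitMass_locallyUniform_nonneg :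
    BulkKerrCaptureC2 ↔
      ∀ [Kerr.Facts] [Kerr.SliceFacts], ∀ χ : ℝ, 0 ≤ χ → χ < 1 → ∃ (s : ℕ) (δ : ℝ), ∃ ς > (0 : ℝ), ∀ η > (0 : ℝ),
        ∃ ε > (0 : ℝ), ∀ a : ℝ, |a - χ| < ς → Kerr.IsSubextremal 1 a → CaptureC2At s δ 1 zero_le_one ε η a := by
  rw [Scaling.bulkKerrCaptureC2_iff_unitMass_locallyUniform]
  constructor
  · intro h _ _ χ h0 hχ
    exact h χ (by rwa [abs_of_nonneg h0])
  · intro h _ _ χ hχ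
    rcases le_or_gt 0 χ with h0 | h0
    · exact h χ h0 ((le_abs_self χ).trans_lt hχ)
    · -- a negative centre is served by the data of the centre `−χ`
      have hχ' : -χ < 1 := (neg_le_abs χ).trans_lt hχ
      obtain ⟨s, δ, ς, hς, H⟩ := h (-χ) (by linarith) hχ'
      refine ⟨s, δ, ς, hς, fun η hη ↦ ?_⟩
      obtain ⟨ε, hε, Hε⟩ := H η hη
      refine ⟨ε, hε, fun a ha hsub ↦ captureC2At_neg_iff.1 (Hε (-a) ?_ ((isSubextremal_neg_iff 1 a).2 hsub))⟩
      have e : -a - -χ = -(a - χ) := by ring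
      rwa [e, abs_neg]

/-- **Registered sub-goal `stub_bulkKerrCaptureC2_iff_unitMass_locallyUniform_nonneg`** (crux item
stmt-FinalStateConjecture-14985): the crux ⇔ locally uniform unit-mass `C²` capture around each centre `χ ∈ [0, 1)`
(closed form of `bulkKerrCaptureC2_iff_unitMass_locallyUniform_nonneg`). [cite: ONeill1995, Ch. 2 §2.1] -/
theorem stub_bulkKerrCaptureC2_iff_unitMass_locallyUniform_nonneg : BulkKerrCaptureC2 ↔ ∀ [Kerr.Facts] [Kerr.SliceFacts], ∀ χ : ℝ, 0 ≤ χ → χ < 1 → ∃ (s : ℕ) (δ : ℝ), ∃ ς > (0 : ℝ), ∀ η > (0 : ℝ), ∃ ε > (0 : ℝ), ∀ a : ℝ, |a - χ| < ς → Kerr.IsSubextremal 1 a → CaptureC2At s δ 1 zero_le_one ε η a :=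
  bulkKerrCaptureC2_iff_unitMass_locallyUniform_nonneg

end Summit.FinalStateConjecture.FinalStateConjecture.Theorems.BulkKerrCaptureC2.Reflection

end
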